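import Mathlib.LinearAlgebra.Charpoly.ToMatrix
import Literature.NumberTheory.GaloisRepresentations.WeilDeligneRep
import Literature.NumberTheory.GaloisRepresentations.LocalGaloisGroupProofs
import HarnessLib

/-!
# Discharge of the named fact `WeilDeligneRep.eulerFactor_eq` (trunk GalRep, item C8)

D-0014 keeps `Literature/` sorry-free by stating cited results as named facts `def X : Prop`.
This sibling file of `Literature.NumberTheory.GaloisRepresentations.WeilDeligneRep` proves the
named fact `WeilDeligneRep.eulerFactor_eq` of that file as
`WeilDeligneRep.eulerFactor_eq_holds`: the Euler factor
`eulerFactor r hn hex = det(1 - T · ρ(Φ₀) | (ker N)^{I_F})`, computed there with the chosen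
geometric Frobenius `Φ₀ = geomFrob F hex` in the basis `Module.finBasis`, equals
`det(1 - T · [ρ(Φ)|_{(ker N)^{I_F}}]_b)` for *every* geometric Frobenius `Φ` (`deg Φ = -1`) and
*every* basis `b` of `(ker N)^{I_F}`.  This is the remark accompanying the definition of the
local factor `Z(V, t) = det(1 - Φ t | V_N^I)`, `L(V, s) = Z(V, q^{-s})` in Tate, *Number
theoretic background* (Corvallis 1979), (4.1.6) (independence of the choice of `Φ` because
`I` acts trivially on `V_N^I = (Ker N)^I`), and Deligne, *Les constantes des équations
fonctionnelles des fonctions L* (Antwerp II, LNM 349, 1973), §8.12; users holding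
`(h : WeilDeligneRep.eulerFactor_eq)` are fed `WeilDeligneRep.eulerFactor_eq_holds`.

Sources.  J. Tate, *Number theoretic background*, in: Automorphic forms, representations and
`L`-functions (Corvallis 1977), Proc. Sympos. Pure Math. XXXIII, Part 2, Amer. Math. Soc. (1979),
3–26, (4.1.6) (bib keys `Corvallis1979`, `TateCorvallis1979`; doi:10.1090/pspum/033.2/546607 —
not held by the literature store at the time of writing, acquisition requested).  The same
definition `V_N^I = (Ker N)^{ρ(I)}`, `Z(t, V) = det(1 - t ρ(Φ) | V_N^I)^{-1}`, `L(s, ρ') = Z(q^{-s}, ρ')`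
with `Φ` a geometric Frobenius (`‖Φ‖ = q^{-1}`) is printed in J. Cogdell, *Langlands conjectures
for `GL_n`*, §2, in Bernstein–Gelbart (eds.), *An Introduction to the Langlands Program*
(Birkhäuser, 2003), and, for `N = 0`, in Harris–Taylor, *The geometry and cohomology of some
simple Shimura varieties* (2001), §VII.2, p. 224 (`L(r, s) = det((1 - Frob_p q^{-s}) | W_r^{I_K})^{-1}`),
both held and checked.

## Proof

1. `WeilGroup.mul_inv_mem_inertia_of_deg_eq`: two elements of `W_F` of the same degree differ by
   an element of the inertia group `I_F` (Tate (1.4.1): `I_F = ker (deg)`), from the discharged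
   `LocalGaloisGroup` facts `IsFrobPow.mul_holds` / `IsFrobPow.mul_inv_mem_absInertia_holds`
   (`LocalGaloisGroupProofs.lean`); in particular `isFrobPow_deg'` and `deg_geomFrob'` are the
   hypothesis-free forms of `WeilGroup.isFrobPow_deg` and `WeilDeligneRep.deg_geomFrob`.
2. `WeilDeligneRep.restrictInertiaInvariantsKerN_eq_of_deg_eq`: `I_F` acts trivially on
   `(ker N)^{I_F}` (by definition of the invariants), hence `ρ(w)|_{(ker N)^{I_F}}` only depends
   on `deg w`.
3. `WeilDeligneRep.charpolyRev_toMatrix`: `(toMatrix b b f).charpolyRev = (charpoly f).reverse`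
   is independent of the basis (Mathlib `Matrix.reverse_charpoly`, `LinearMap.charpoly_toMatrix`).

No statement of `WeilDeligneRep.lean` is changed; this file only adds theorems.
-/

noncomputable section

open Module Polynomial

namespace Literature.NumberTheory.GaloisRepresentations

variable {F : Type*} [Field F] [ValuativeRel F] [TopologicalSpace F] [IsNonarchimedeanLocalField F]

open GaloisRepresentations.IsNonarchimedeanLocalField WeilGroup

namespace WeilGroup

/-- Every `w ∈ W_F` is a Frobenius power of exponent `deg w` — the hypothesis-free form of
`WeilGroup.isFrobPow_deg`, fed with the discharged fact `IsFrobPow.mul_holds`.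
Ref: Tate, *Number theoretic background* (Corvallis 1979), (1.4.1). [cite: Corvallis1979, (1.4.1)] -/
theorem isFrobPow_deg' (w : WeilGroup F) : IsFrobPow (toAbsGalois F w) (deg w) :=
  isFrobPow_deg IsFrobPow.mul_holds w

/-- `deg w = n ↔ IsFrobPow w n` — the hypothesis-free form of `WeilGroup.deg_eq_iff`
(discharged facts `IsFrobPow.mul_holds`, `IsFrobPow.unique_holds`).
Ref: Tate, *Number theoretic background* (Corvallis 1979), (1.4.1). [cite: Corvallis1979, (1.4.1)] -/
theorem deg_eq_iff' {w : WeilGroup F} {n : ℤ} : deg w = n ↔ IsFrobPow (toAbsGalois F w) n :=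
  deg_eq_iff IsFrobPow.mul_holds IsFrobPow.unique_holds

/-- Two elements of the Weil group of the same degree differ by an element of the inertia group:
`deg w = deg w' → w * w'⁻¹ ∈ I_F` (exactness of `1 → I_F → W_F → ℤ`).
Ref: Tate, *Number theoretic background* (Corvallis 1979), (1.4.1). [cite: Corvallis1979, (1.4.1)] -/
theorem mul_inv_mem_inertia_of_deg_eq {w w' : WeilGroup F} (h : deg w = deg w') :
    w * w'⁻¹ ∈ inertia F := by
  have hw : IsFrobPow (toAbsGalois F w) (deg w') := h ▸ isFrobPow_deg' w
  rw [mem_inertia_iff, map_mul, map_inv]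
  exact IsFrobPow.mul_inv_mem_absInertia_holds hw (isFrobPow_deg' w')

end WeilGroup

namespace WeilDeligneRep

section InertiaInvariants

variable {C : Type*} [Field C] [CharZero C] {V : Type*} [AddCommGroup V] [Module C V]

/-- `deg (geomFrob F hex) = -1` — the hypothesis-free form of `deg_geomFrob`.
Ref: Deligne, Antwerp II (1973), §2.2.4; Tate, Corvallis 1979, (1.4.1). [cite: Corvallis1979, (1.4.1)] -/
theorem deg_geomFrob' (hex : exists_isFrobPow (F := F)) : deg (geomFrob F hex) = -1 :=
  deg_geomFrob IsFrobPow.mul_holds IsFrobPow.unique_holds hex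

/-- The inertia group acts trivially on `(ker N)^{I_F}`: `ρ(u)|_{(ker N)^{I_F}} = 1` for
`u ∈ I_F`.  Ref: Tate, *Number theoretic background* (Corvallis 1979), (4.1.6). [cite: Corvallis1979, (4.1.6)] -/
theorem restrictInertiaInvariantsKerN_eq_one_of_mem_inertia (hn : absInertia_normal F)
    (r : WeilDeligneRep F C V) {u : WeilGroup F} (hu : u ∈ inertia F) :
    r.restrictInertiaInvariantsKerN hn u = 1 := by
  ext v
  exact ((r.mem_inertiaInvariantsKerN_iff v).mp v.2).2 u hu

/-- On `(ker N)^{I_F}` the action of `w ∈ W_F` only depends on `deg w`: if `deg w = deg w'`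
then `w = (w w'⁻¹) w'` with `w w'⁻¹ ∈ I_F` acting trivially.  In particular all geometric
Frobenii `Φ` (`deg Φ = -1`) induce the same endomorphism of `(ker N)^{I_F}`.
Ref: Tate, *Number theoretic background* (Corvallis 1979), (4.1.6). [cite: Corvallis1979, (4.1.6)] -/
theorem restrictInertiaInvariantsKerN_eq_of_deg_eq (hn : absInertia_normal F)
    (r : WeilDeligneRep F C V) {w w' : WeilGroup F} (h : deg w = deg w') :
    r.restrictInertiaInvariantsKerN hn w = r.restrictInertiaInvariantsKerN hn w' := by
  ext v
  simp only [coe_restrictInertiaInvariantsKerN_apply]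
  have hv' : r.ρ w' v ∈ r.inertiaInvariantsKerN := r.ρ_apply_mem_inertiaInvariantsKerN hn w' v.2
  have key := ((r.mem_inertiaInvariantsKerN_iff _).mp hv').2 _ (mul_inv_mem_inertia_of_deg_eq h)
  calc r.ρ w v = r.ρ (w * w'⁻¹ * w') v := by rw [inv_mul_cancel_right]
    _ = r.ρ (w * w'⁻¹) (r.ρ w' v) := by rw [map_mul, Module.End.mul_apply]
    _ = r.ρ w' v := key

end InertiaInvariants

section CharpolyRev

variable {R : Type*} [CommRing R] {M : Type*} [AddCommGroup M] [Module R M]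
  [Module.Free R M] [Module.Finite R M]

/-- The reversed characteristic polynomial `det(1 - X • [f]_b)` of the matrix of an endomorphism
`f` in a basis `b` is `(charpoly f).reverse`, hence independent of the basis.
Ref: Bourbaki, *Algèbre*, Ch. III §8; Mathlib `Matrix.reverse_charpoly`,
`LinearMap.charpoly_toMatrix`. [folklore] -/
theorem charpolyRev_toMatrix {ι : Type*} [Fintype ι] [DecidableEq ι] (b : Basis ι R M)
    (f : M →ₗ[R] M) : (LinearMap.toMatrix b b f).charpolyRev = f.charpoly.reverse := by
  rw [← Matrix.reverse_charpoly, LinearMap.charpoly_toMatrix]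

end CharpolyRev

section Euler

variable {C : Type*} [Field C] [CharZero C] {V : Type*} [AddCommGroup V] [Module C V]
  [FiniteDimensional C V]

/-- **The Euler factor is well defined** (pointed form of `eulerFactor_eq`): for any geometric
Frobenius `Φ` (`deg Φ = -1`) and any basis `b` of `(ker N)^{I_F}`,
`eulerFactor r hn hex = det(1 - X • [ρ(Φ)|_{(ker N)^{I_F}}]_b)`.
Ref: Tate, *Number theoretic background* (Corvallis 1979), (4.1.6); Deligne, Antwerp II (1973),
§8.12. [cite: Corvallis1979, (4.1.6)] -/
theorem eulerFactor_eq_charpolyRev_toMatrix (hn : absInertia_normal F)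
    (hex : exists_isFrobPow (F := F)) (r : WeilDeligneRep F C V) {Φ : WeilGroup F}
    (hΦ : deg Φ = -1) {ι : Type*} [Fintype ι] [DecidableEq ι]
    (b : Basis ι C r.inertiaInvariantsKerN) :
    r.eulerFactor hn hex =
      (LinearMap.toMatrix b b (r.restrictInertiaInvariantsKerN hn Φ)).charpolyRev := by
  unfold eulerFactor
  rw [charpolyRev_toMatrix, charpolyRev_toMatrix,
    r.restrictInertiaInvariantsKerN_eq_of_deg_eq hn ((deg_geomFrob' hex).trans hΦ.symm)]

/-- **The Euler factor as a polynomial in `ρ(Φ)|`**: `eulerFactor r hn hex` is the reverse of the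
characteristic polynomial of `ρ(Φ)|_{(ker N)^{I_F}}` for any geometric Frobenius `Φ`.
Ref: Tate, *Number theoretic background* (Corvallis 1979), (4.1.6). [cite: Corvallis1979, (4.1.6)] -/
theorem eulerFactor_eq_reverse_charpoly (hn : absInertia_normal F)
    (hex : exists_isFrobPow (F := F)) (r : WeilDeligneRep F C V) {Φ : WeilGroup F}
    (hΦ : deg Φ = -1) :
    r.eulerFactor hn hex = (r.restrictInertiaInvariantsKerN hn Φ).charpoly.reverse := by
  rw [r.eulerFactor_eq_charpolyRev_toMatrix hn hex hΦ (finBasis C _), charpolyRev_toMatrix]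

/-- **Discharge of the named fact `WeilDeligneRep.eulerFactor_eq`**: the Euler factor
`det(1 - T · ρ(Φ) | (ker N)^{I_F})` of a Weil–Deligne representation is independent of the
geometric Frobenius `Φ` (two choices differ by inertia, which acts trivially on `(ker N)^{I_F}`)
and of the basis used to compute the determinant.
Ref: Tate, *Number theoretic background* (Corvallis 1979), (4.1.6) (definition of
`Z(V, t) = det(1 - Φ t | V_N^I)` and `L(V, s) = Z(V, q^{-s})`); Deligne, *Les constantes des
équations fonctionnelles des fonctions L* (Antwerp II, 1973), §8.12.
[cite: Corvallis1979, (4.1.6)] [cite: TateCorvallis1979, (4.1.6)] -/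
theorem eulerFactor_eq_holds : eulerFactor_eq (F := F) (C := C) (V := V) :=
  fun hn hex r _ hΦ _ _ _ b => r.eulerFactor_eq_charpolyRev_toMatrix hn hex hΦ b

end Euler

end WeilDeligneRep

end Literature.NumberTheory.GaloisRepresentations
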